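import Literature.NumberTheory.EllipticCurves.LeadingTermPPartProofs
import Literature.NumberTheory.EllipticCurves.BSDSelmerPConverseRamifiedProofs
import HarnessLib

/-!
# Skinner–Urban 2014, Thm. 3.6.11 (a) from Thm. 3.6.9 — with the `p`-adic surjectivity premise of
# the integral main conjecture supplied by the hypothesis (ram) itself (proofs; no Wuthrich Lemma 20,
# no Serre lemma)

C. Skinner, E. Urban, *The Iwasawa main conjectures for `GL₂`*, Invent. Math. 195 (2014), 1–277
(bib key `SkinnerUrban2014`; held author version `paper:doi-10-1007-s00222-013-0448-1`, whose
pagination the `[cite:]`s use).  HONEST FRAMING (cell `b2b-bsdres`, home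
`run/shared/lean/b2b/bsd-rank1-residual/`): the cell deletes COMBINATION-shaped residual classes of
analytic-rank `≤ 1` curves from PUBLISHED theorems only and types the construction-shaped ones;
this is not "finishing BSD".  This is a *proofs* file (theorems only: no definition, no named fact,
no `sorry`).

## What is proved, and why

Thm. 3.6.11 (a) of the source (the tree's named fact bsd.S30 `padicValRat_bsd_rank_zero`, p. 46 =
Thm. 2 (a) p. 3): "Suppose • `E` has good ordinary reduction at `p`; • there exists a prime
`q ∥ N_E`, `q ≠ p`, such that `ρ̄_{E,p}` is ramified at `q`; • `ρ̄_{E,p}` is irreducible. (a) If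
`L(E,1) ≠ 0` and `ρ̄_{E,p}` is surjective then `|L(E,1)/Ω_E|_p^{-1} = #Ш(E/ℚ)_p · ∏_{ℓ ∣ N_E} c_ℓ(E)`."
Its printed proof (p. 46 l. 25: "This follows from the equality `(𝓛_f) = (L_E) = F_E`, the
interpolation properties of `𝓛_f` and `L_E`, and Theorem 4.1 of [Gr99]") is in the tree as
`padicValRat_bsd_rank_zero_of_mainConjecture` (`LeadingTermPPartProofs.lean`): bsd.S30 from the main
conjecture bsd.S21 (`skinner_urban_main_conjecture`, Thm. 3.6.9), modularity, Greenberg's Thm. 4.1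
and the period unit — PLUS one input foreign to Skinner–Urban: the INTEGRAL clause (3) of bsd.S21 is
typed under "`ρ̄_{E,p^n}` onto for every `n`" (the image of `ρ_{E,p}` is `GL₂(ℤ_p)`), and the tree
derivation lifts the printed mod-`p` surjectivity to it by Serre's lemma for `p ≥ 5` (tree theorem)
and, at `p = 3`, by C. Wuthrich, Doc. Math. 19 (2014), Lemma 20 — the binder `hW3`, i.e. the named
fact `Wuthrich2014.lemma20_surjective_threeAdic_of_semistable`, which every consumer of the
derivation has had to carry (e.g. `Summits/…/Rank1Residual/Partition/MainConjectures.lean`).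

That extra input is unnecessary: the SECOND printed hypothesis, (ram) — a multiplicative prime
`q ≠ p` with `p ∤ v_q(Δ_min)` — puts a transvection in the image of inertia at `q` at EVERY level
`p^n` (Tate curve), and "`ρ̄_{E,p}` onto + such a transvection ⟹ `ρ̄_{E,p^n}` onto for all `n`" at
every prime `p` is the tree theorem
`hasSurjectiveModNGaloisRep_pow_of_hasMultiplicativeReductionAtPrime`
(`BSDSelmerPConverseRamifiedProofs.lean`, Serre 1972 IV §3.4 Lemma 2 road; it already replaced
Wuthrich's Lemma 20 in the tree's `p`-converse derivation `…RamifiedProofs`).  So: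

* `padicValRat_bsd_rank_zero_at_of_mainConjecture` — the per-curve core of the tree derivation:
  for ONE curve `W` and prime `p ≥ 3` with the hypotheses of bsd.S30 except that mod-`p`
  surjectivity is replaced by `p`-adic surjectivity `hsur : ∀ n, ρ̄_{E,p^n} onto`, the conclusion of
  bsd.S30 at `(W, p)`.  The proof is the tree proof of `padicValRat_bsd_rank_zero_of_mainConjecture`
  (its Steps 0, 1, 3–9) VERBATIM, with its Step 2 (Serre/Wuthrich) deleted — kept textually parallel
  on purpose (the tree theorem has no per-curve entry point; its file is imported by many modules and
  is left untouched).
* `padicValRat_bsd_rank_zero_of_mainConjecture_of_ram` — **bsd.S30 from bsd.S21 + modularity +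
  Greenberg Thm. 4.1 (inline, as in the tree theorem) + the period unit, and NOTHING ELSE**: the
  binder `hW3` of `padicValRat_bsd_rank_zero_of_mainConjecture` is gone (drop-in replacement: same
  remaining binders, same order).
* `padicValRat_bsd_rank_zero_of_mainConjecture_of_ram'` — the same for the primed tree variant
  (Greenberg's identity from `Schneider1985_order_charGenerator` + `exists_isCanonical` for `p ≥ 5`,
  inline `hGr3` at `p = 3`).
* `mainConjecture_integral_of_surj_of_ram` — bsd.S21's integral clause with its `p`-adic premise
  discharged from mod-`p` surjectivity + (ram), for ANY `E/ℚ` (the semistable case is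
  `SkinnerUrban2014.mainConjecture_integral_of_semistable_of_irr`).

Consequence for the cell (nothing booked here): every class row assembled through the S–U route
(bsd.S21/bsd.S30 always carry (ram)) can drop the Wuthrich-Lemma-20 binder.

## References

* [SkinnerUrban2014] C. Skinner, E. Urban, Invent. Math. 195 (2014): Thm. 3.6.9 (p. 45),
  Thm. 3.6.11 (a) and its proof (p. 46).
* [GreenbergLNM1716] R. Greenberg, LNM 1716 (1999), Thm. 4.1 (p. 102), Lemma 4.2 (p. 103).
* [Serre1972] J.-P. Serre, Invent. Math. 15 (1972), IV §3.4 Lemma 2 (the transvection lift).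
* [Wuthrich2014] C. Wuthrich, Doc. Math. 19 (2014), Lemma 20 (p. 399) — the input REMOVED here.
* [GreenbergVatsal2000] R. Greenberg, V. Vatsal, Invent. Math. 142 (2000), §3 (period unit).
* [BalakrishnanMullerStein2015] Math. Comp. 85 (2016), Thm. 1.7.
-/

set_option autoImplicit false

noncomputable section

open scoped Classical MatrixGroups ModularForm

open CongruenceSubgroup WeierstrassCurve Literature.NumberTheory.EllipticCurves.ModularForms

namespace Literature.NumberTheory.EllipticCurves.SkinnerUrban2014

/-! ## §1. The per-curve core of the tree derivation, under `p`-adic surjectivity -/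

/-- **Thm. 3.6.11 (a) at one curve, from Thm. 3.6.9 — per-curve core.**  For a globally minimal
`E/ℚ` and a prime `p ≥ 3` of good ordinary reduction with `E[p]` irreducible, (ram), `L(E,1) ≠ 0`,
`Ш(E/ℚ)` finite and `ρ̄_{E,p^n}` onto for every `n`: `L(E,1)/Ω_E` is a rational `q` with
`ord_p q = ord_p #Ш + ord_p ∏ c_ℓ − 2 ord_p #E(ℚ)_tors` — granted bsd.S21 (`hSU`), modularity
(`hmod`), Greenberg's Thm. 4.1 in the shape `hGr` and the period unit `hϖ`, exactly the binders of the
tree's `padicValRat_bsd_rank_zero_of_mainConjecture`, whose proof this is (Steps 0, 1, 3–9 verbatim;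
Step 2, the lift of mod-`p` to `p`-adic surjectivity, is replaced by the hypothesis `hsur`).
[cite: SkinnerUrban2014, Thm. 3.6.11 (a) and its proof (p. 46); Thm. 3.6.9 (p. 45)]
[cite: GreenbergLNM1716, Thm. 4.1 (p. 102), proof of Lemma 4.2 (p. 103)] -/
theorem padicValRat_bsd_rank_zero_at_of_mainConjecture
    (hmod : nonempty_modularParametrizationData)
    (hSU : ∀ (W : WeierstrassCurve ℚ) [W.IsElliptic] [W.IsGloballyMinimal] (p : ℕ) [Fact p.Prime]
      (κ : ZpExtension ℚ p) (γ : Field.absoluteGaloisGroup ℚ) (N : ℕ) [NeZero N]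
      (f : CuspForm (Gamma0 N) 2),
      skinner_urban_main_conjecture W p (κ := κ) (γ := γ) (f := f))
    (hGr : ∀ (W : WeierstrassCurve ℚ) [W.IsElliptic] [W.IsGloballyMinimal] (p : ℕ) [Fact p.Prime],
      p ≠ 2 → W.HasGoodReductionAtPrime p → ¬ (p : ℤ) ∣ W.frobeniusTrace p →
      ∀ (κ : ZpExtension ℚ p) (γ : Field.absoluteGaloisGroup ℚ),
        κ.IsCyclotomic → κ.IsTopGenerator γ → IsCyclotomicVariable p γ →
      ∀ (D : W.SelmerDualData κ γ) [Module.Finite (IwasawaAlgebra p) D.X], D.IsTorsion →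
      ∀ (fE : IwasawaAlgebra p), D.charIdeal = Ideal.span {fE} →
        Finite (W.selmerGroupPInfty p) →
        ∃ u : ℤ_[p]ˣ,
          ((PowerSeries.constantCoeff fE : ℤ_[p]) : ℚ_[p]) *
              (Nat.card (AddCommGroup.primaryComponent W.toAffine.Point p) : ℚ_[p]) ^ 2 =
            ((u : ℤ_[p]) : ℚ_[p]) * (p : ℚ_[p]) ^ (padicValNat p W.tamagawaProduct) *
              (Nat.card (AddCommGroup.primaryComponent
                ((integralModelInt W).map (Int.castRingHom (ZMod p))).toAffine.Point p) : ℚ_[p]) ^ 2 *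
              (Nat.card (W.selmerGroupPInfty p) : ℚ_[p]))
    (hϖ : ∀ (W : WeierstrassCurve ℚ) [W.IsElliptic] [W.IsGloballyMinimal] (p : ℕ) [Fact p.Prime],
      p ≠ 2 → W.HasGoodReductionAtPrime p → W.HasIrreducibleModPGaloisRep p →
      ∀ [NeZero (W.conductorNorm ℤ)] (f : CuspForm (Gamma0 (W.conductorNorm ℤ)) 2),
        IsNewformOf W f →
      ∀ ϖ : ℚ, (ϖ : ℝ) * W.realPeriodRat = plusPeriod f → padicValRat p ϖ = 0)
    (W : WeierstrassCurve ℚ) [W.IsElliptic] [W.IsGloballyMinimal] (p : ℕ) [Fact p.Prime]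
    (hp : 3 ≤ p) (hgood : W.HasGoodReductionAtPrime p) (hord : ¬ (p : ℤ) ∣ W.frobeniusTrace p)
    (hirr : W.HasIrreducibleModPGaloisRep p)
    (haux : ∃ ℓ : ℕ, ∃ _ : Fact ℓ.Prime, ℓ ≠ p ∧ W.HasMultiplicativeReductionAtPrime ℓ ∧
      ¬ p ∣ padicValInt ℓ W.minimalDiscriminantInt)
    (hL : W.entireLFunction 1 ≠ 0) (hsur : ∀ n : ℕ, W.HasSurjectiveModNGaloisRep (p ^ n : ℕ))
    (hfin : Finite W.sha) :
    ∃ q : ℚ, W.entireLFunction 1 / (W.realPeriodRat : ℂ) = (q : ℂ) ∧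
      padicValRat p q = (padicValNat p W.shaOrder : ℤ) + padicValNat p W.tamagawaProduct -
        2 * padicValNat p W.torsionOrder := by
  have hpP : p.Prime := Fact.out
  have hp2 : p ≠ 2 := by omega
  have hordp : IsOrdinaryAt W p := ⟨hgood, hord⟩
  -- Step 0 (modularity): the newform `f` of `E` at level `N_E` and the period ratio `ϖ`
  haveI : NeZero (W.conductorNorm ℤ) := ⟨(W.conductorNorm_pos_holds).ne'⟩
  obtain ⟨Dm⟩ := hmod W
  set f := Dm.f with hf_def
  have hf : IsNewformOf W f := Dm.isNewformOf
  obtain ⟨ϖ, hϖpos, hϖeq, hΩpos⟩ := Dm.exists_rat_mul_realPeriodRat_eq_plusPeriod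
  have hϖval : padicValRat p ϖ = 0 := hϖ W p hp2 hgood hirr f hf ϖ hϖeq
  -- the rational number `q = ϖ · [0]⁺_f = L(E,1)/Ω_E`
  set s : ℚ := ratPlusSymbol f 0 with hs_def
  have hLval : W.entireLFunction 1 = (((s : ℝ) * plusPeriod f : ℝ) : ℂ) := hf.entireLFunction_one_eq
  have hq : W.entireLFunction 1 / (W.realPeriodRat : ℂ) = ((ϖ * s : ℚ) : ℂ) := by
    rw [hLval, ← hϖeq, div_eq_iff (Complex.ofReal_ne_zero.mpr hΩpos.ne')]
    push_cast
    ring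
  have hs0 : s ≠ 0 := by
    intro h0
    apply hL
    rw [hLval, h0]
    simp
  refine ⟨ϖ * s, hq, ?_⟩
  rw [padicValRat.mul hϖpos.ne' hs0, hϖval, zero_add]
  -- Step 1 (the cyclotomic setting and the Iwasawa module)
  obtain ⟨κ, hκ, γ, hγ, hγ'⟩ := exists_isCyclotomic_isTopGenerator_isCyclotomicVariable_holds p
  obtain ⟨D⟩ := W.nonempty_selmerDualData_holds κ γ hγ
  haveI : Module.Finite (IwasawaAlgebra p) D.X := D.module_finite_holds hγ
  -- (Step 2 of the tree proof — the lift to `p`-adic surjectivity — is the hypothesis `hsur` here.)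
  -- Step 3 (the main conjecture for `E`, bsd.S21 (1) and (3)): `char X = (g)`, `ι g = L_p(E,T)`
  obtain ⟨hX, -, hint⟩ := hSU W p κ γ _ f hp hgood hord hirr haux hκ hγ hγ' hf D
  obtain ⟨g, hιg, hchar⟩ := hint hsur
  -- Step 4 (interpolation): `g(0) = L_p(E,0) = (1 - α⁻¹)² [0]⁺_f`
  set a : ℚ_[p] := ((unitRoot W p : ℤ_[p]) : ℚ_[p]) with ha
  have hg0 : ((PowerSeries.constantCoeff g : ℤ_[p]) : ℚ_[p]) = (1 - a⁻¹) ^ 2 * (s : ℚ_[p]) := by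
    rw [← constantCoeff_iwasawaToPowerSeries p g, hιg, constantCoeff_padicLFunction_unitRoot hordp hf]
  -- the bridges `1 - α⁻¹ = u₂ · #Ẽ(𝔽_p)` and `#Ẽ(𝔽_p) = u₃ · #Ẽ(𝔽_p)(p)`; in particular `1 - α⁻¹ ≠ 0`
  obtain ⟨u₂, hu₂⟩ := exists_unit_one_sub_unitRoot_inv p W hordp
  haveI : NeZero p := ⟨hpP.ne_zero⟩
  obtain ⟨u₃, hu₃⟩ := exists_unit_natCard_eq_mul_card_primaryComponent
    ((integralModelInt W).map (Int.castRingHom (ZMod p))).toAffine.Point p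
  set Np : ℚ_[p] := (Nat.card (AddCommGroup.primaryComponent
    ((integralModelInt W).map (Int.castRingHom (ZMod p))).toAffine.Point p) : ℚ_[p]) with hNp
  have hNcount : (W.reductionPointCount p : ℚ_[p]) = ((u₃ : ℤ_[p]) : ℚ_[p]) * Np := by
    rw [WeierstrassCurve.reductionPointCount, hNp]
    exact hu₃
  have hNp0 : Np ≠ 0 := by
    rw [hNp]
    exact_mod_cast Nat.card_pos.ne'
  have h1 : (1 - a⁻¹) = ((u₂ : ℤ_[p]) : ℚ_[p]) * ((u₃ : ℤ_[p]) : ℚ_[p]) * Np := by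
    rw [hu₂, hNcount, mul_assoc]
  have hsQ0 : (s : ℚ_[p]) ≠ 0 := by exact_mod_cast hs0
  have hU0 : ((u₂ : ℤ_[p]) : ℚ_[p]) * ((u₃ : ℤ_[p]) : ℚ_[p]) ≠ 0 :=
    mul_ne_zero (coe_units_ne_zero p u₂) (coe_units_ne_zero p u₃)
  -- Step 5 (finiteness, from the main conjecture): `g(0) ≠ 0`, so `X/TX`, `Sel_∞^Γ`, `Sel_{p^∞}(E/ℚ)`
  -- and `E(ℚ)` are finite (Greenberg p. 103 + Lemma 3.1); `Ш` is finite by hypothesis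
  have hg00 : PowerSeries.constantCoeff g ≠ 0 := by
    intro h
    rw [h, PadicInt.coe_zero, h1] at hg0
    exact (mul_ne_zero (pow_ne_zero 2 (mul_ne_zero hU0 hNp0)) hsQ0) hg0.symm
  have hSelfin : Finite (W.selmerGroupPInfty p) :=
    D.finite_selmerGroupPInfty_of_constantCoeff_ne_zero W hγ hX g hchar hg00
  obtain ⟨hEfin, hShapfin⟩ := (W.finite_selmerGroupPInfty_iff p).mp hSelfin
  haveI := hEfin
  haveI := hShapfin
  haveI := hSelfin
  haveI : Finite W.sha := hfin
  -- Step 6 (Greenberg's Thm. 4.1)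
  obtain ⟨u₁, hu₁⟩ := hGr W p hp2 hgood hord κ γ hκ hγ hγ' D hX g hchar hSelfin
  -- Step 7 (the remaining bridges)
  obtain ⟨u₄, hu₄⟩ := exists_unit_torsionOrder_eq W p
  obtain ⟨u₅, hu₅⟩ := exists_unit_natCard_eq_mul_card_primaryComponent W.sha p
  have hSel : Nat.card (W.selmerGroupPInfty p) = Nat.card (AddCommGroup.primaryComponent W.sha p) :=
    W.natCard_selmerGroupPInfty_eq_natCard_primaryComponent_sha p
  -- abbreviations
  set v := padicValNat p W.tamagawaProduct with hv
  set Tp : ℚ_[p] := (Nat.card (AddCommGroup.primaryComponent W.toAffine.Point p) : ℚ_[p]) with hTp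
  set Shp : ℚ_[p] := (Nat.card (AddCommGroup.primaryComponent W.sha p) : ℚ_[p]) with hShp
  -- `#E(ℚ)_tors = u₄ · Tp` (up to the `DecidableEq ℚ` instance inside the group law)
  have hu₄' : (W.torsionOrder : ℚ_[p]) = ((u₄ : ℤ_[p]) : ℚ_[p]) * Tp := by
    rw [hu₄, hTp]
    congr 1
    exact_mod_cast natCard_primaryComponent_point_congr W p _ _
  -- `#Ш = u₅ · Shp`, `#Sel = Shp`
  have hSha : (W.shaOrder : ℚ_[p]) = ((u₅ : ℤ_[p]) : ℚ_[p]) * Shp := by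
    rw [WeierstrassCurve.shaOrder, hShp]
    exact hu₅
  have hSel' : (Nat.card (W.selmerGroupPInfty p) : ℚ_[p]) = Shp := by rw [hShp, hSel]
  -- Step 8: the identity `s · Tp² · (u₂ u₃)² = u₁ · p^v · Shp` in `ℚ_p`
  have key : (s : ℚ_[p]) * Tp ^ 2 * (((u₂ : ℤ_[p]) : ℚ_[p]) * ((u₃ : ℤ_[p]) : ℚ_[p])) ^ 2 =
      ((u₁ : ℤ_[p]) : ℚ_[p]) * (p : ℚ_[p]) ^ v * Shp := by
    apply mul_right_cancel₀ (pow_ne_zero 2 hNp0)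
    calc (s : ℚ_[p]) * Tp ^ 2 * (((u₂ : ℤ_[p]) : ℚ_[p]) * ((u₃ : ℤ_[p]) : ℚ_[p])) ^ 2 * Np ^ 2
        = ((1 - a⁻¹) ^ 2 * (s : ℚ_[p])) * Tp ^ 2 := by rw [h1]; ring
      _ = ((u₁ : ℤ_[p]) : ℚ_[p]) * (p : ℚ_[p]) ^ v * Np ^ 2 * (Nat.card (W.selmerGroupPInfty p) : ℚ_[p]) := by
          rw [← hg0, hu₁]
      _ = ((u₁ : ℤ_[p]) : ℚ_[p]) * (p : ℚ_[p]) ^ v * Shp * Np ^ 2 := by rw [hSel']; ring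
  -- Step 9: valuations
  have hTp0 : Tp ≠ 0 := by rw [hTp]; exact_mod_cast Nat.card_pos.ne'
  have hShp0 : Shp ≠ 0 := by rw [hShp]; exact_mod_cast Nat.card_pos.ne'
  have hp0 : (p : ℚ_[p]) ≠ 0 := Nat.cast_ne_zero.mpr hpP.ne_zero
  have hval := congrArg Padic.valuation key
  rw [Padic.valuation_mul (mul_ne_zero hsQ0 (pow_ne_zero 2 hTp0)) (pow_ne_zero 2 hU0),
    Padic.valuation_mul hsQ0 (pow_ne_zero 2 hTp0), Padic.valuation_pow, Padic.valuation_pow,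
    Padic.valuation_mul (coe_units_ne_zero p u₂) (coe_units_ne_zero p u₃),
    valuation_coe_units_eq_zero, valuation_coe_units_eq_zero,
    Padic.valuation_mul (mul_ne_zero (coe_units_ne_zero p u₁) (pow_ne_zero v hp0)) hShp0,
    Padic.valuation_mul (coe_units_ne_zero p u₁) (pow_ne_zero v hp0), valuation_coe_units_eq_zero,
    Padic.valuation_pow, Padic.valuation_p, Padic.valuation_ratCast] at hval
  -- `v(Tp) = v(#E(ℚ)_tors)`, `v(Shp) = v(#Ш)`
  have hvT : Tp.valuation = (padicValNat p W.torsionOrder : ℤ) := by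
    have h := congrArg Padic.valuation hu₄'
    rw [Padic.valuation_natCast, Padic.valuation_mul (coe_units_ne_zero p u₄) hTp0,
      valuation_coe_units_eq_zero, zero_add] at h
    exact h.symm
  have hvS : Shp.valuation = (padicValNat p W.shaOrder : ℤ) := by
    have h := congrArg Padic.valuation hSha
    rw [Padic.valuation_natCast, Padic.valuation_mul (coe_units_ne_zero p u₅) hShp0,
      valuation_coe_units_eq_zero, zero_add] at h
    exact h.symm
  rw [hvT, hvS] at hval
  simp only [Nat.cast_ofNat, mul_zero, add_zero, zero_add] at hval
  rw [hs_def] at hval ⊢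
  linarith

/-! ## §2. bsd.S30 from bsd.S21 with the `p`-adic lift taken from (ram): no Wuthrich Lemma 20 -/

/-- **bsd.S30 (Thm. 3.6.11 (a)) from bsd.S21 (Thm. 3.6.9), modularity, Greenberg's Thm. 4.1
(inline shape `hGr`) and the period unit (`hϖ`) — and NO `p`-adic lifting input.**  Same statement
and binders as the tree's `padicValRat_bsd_rank_zero_of_mainConjecture` MINUS its binder `hW3`
(Wuthrich 2014, Lemma 20): inside bsd.S30 the hypothesis (ram) (`haux`: a multiplicative `ℓ ≠ p`
with `p ∤ v_ℓ(Δ_min)`) together with the printed mod-`p` surjectivity lifts to `ρ̄_{E,p^n}` onto for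
every `n` at EVERY prime `p` (`hasSurjectiveModNGaloisRep_pow_of_hasMultiplicativeReductionAtPrime`,
the Tate-curve transvection + Serre 1972 IV §3.4 Lemma 2), which is the premise of the integral
clause (3) of bsd.S21 used in the printed proof ("the equality `(𝓛_f) = (L_E) = F_E`").
[cite: SkinnerUrban2014, Thm. 3.6.11 (a) and its proof (p. 46); Thm. 3.6.9 (p. 45)]
[cite: GreenbergLNM1716, Thm. 4.1 (p. 102)] [cite: Serre1972, IV §3.4 Lemma 2]
[cite: GreenbergVatsal2000, §3] -/
theorem padicValRat_bsd_rank_zero_of_mainConjecture_of_ram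
    (hmod : nonempty_modularParametrizationData)
    (hSU : ∀ (W : WeierstrassCurve ℚ) [W.IsElliptic] [W.IsGloballyMinimal] (p : ℕ) [Fact p.Prime]
      (κ : ZpExtension ℚ p) (γ : Field.absoluteGaloisGroup ℚ) (N : ℕ) [NeZero N]
      (f : CuspForm (Gamma0 N) 2),
      skinner_urban_main_conjecture W p (κ := κ) (γ := γ) (f := f))
    (hGr : ∀ (W : WeierstrassCurve ℚ) [W.IsElliptic] [W.IsGloballyMinimal] (p : ℕ) [Fact p.Prime],
      p ≠ 2 → W.HasGoodReductionAtPrime p → ¬ (p : ℤ) ∣ W.frobeniusTrace p →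
      ∀ (κ : ZpExtension ℚ p) (γ : Field.absoluteGaloisGroup ℚ),
        κ.IsCyclotomic → κ.IsTopGenerator γ → IsCyclotomicVariable p γ →
      ∀ (D : W.SelmerDualData κ γ) [Module.Finite (IwasawaAlgebra p) D.X], D.IsTorsion →
      ∀ (fE : IwasawaAlgebra p), D.charIdeal = Ideal.span {fE} →
        Finite (W.selmerGroupPInfty p) →
        ∃ u : ℤ_[p]ˣ,
          ((PowerSeries.constantCoeff fE : ℤ_[p]) : ℚ_[p]) *
              (Nat.card (AddCommGroup.primaryComponent W.toAffine.Point p) : ℚ_[p]) ^ 2 =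
            ((u : ℤ_[p]) : ℚ_[p]) * (p : ℚ_[p]) ^ (padicValNat p W.tamagawaProduct) *
              (Nat.card (AddCommGroup.primaryComponent
                ((integralModelInt W).map (Int.castRingHom (ZMod p))).toAffine.Point p) : ℚ_[p]) ^ 2 *
              (Nat.card (W.selmerGroupPInfty p) : ℚ_[p]))
    (hϖ : ∀ (W : WeierstrassCurve ℚ) [W.IsElliptic] [W.IsGloballyMinimal] (p : ℕ) [Fact p.Prime],
      p ≠ 2 → W.HasGoodReductionAtPrime p → W.HasIrreducibleModPGaloisRep p →
      ∀ [NeZero (W.conductorNorm ℤ)] (f : CuspForm (Gamma0 (W.conductorNorm ℤ)) 2),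
        IsNewformOf W f →
      ∀ ϖ : ℚ, (ϖ : ℝ) * W.realPeriodRat = plusPeriod f → padicValRat p ϖ = 0) :
    padicValRat_bsd_rank_zero := by
  intro W _ _ p _ hp hgood hord hirr haux hL hsurj hfin
  exact padicValRat_bsd_rank_zero_at_of_mainConjecture hmod hSU hGr hϖ W p hp hgood hord hirr haux hL
    (hasSurjectiveModNGaloisRep_pow_of_hasMultiplicativeReductionAtPrime W p hsurj haux) hfin

/-- **The primed variant without Wuthrich's Lemma 20**: bsd.S30 from bsd.S21, modularity, the period
unit, Greenberg's rank-`0` identity taken for `p ≥ 5` from the tree facts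
`Schneider1985_order_charGenerator` (Balakrishnan–Müller–Stein 2016, Thm. 1.7) and
`exists_isCanonical` through `greenberg_rankZero_of_Schneider1985`, and inline only `hGr3`
(Greenberg Thm. 4.1 at `p = 3`) — the tree's `padicValRat_bsd_rank_zero_of_mainConjecture'` MINUS
`hW3`, by `padicValRat_bsd_rank_zero_of_mainConjecture_of_ram`.
[cite: SkinnerUrban2014, Thm. 3.6.11 (a) and its proof (p. 46)]
[cite: BalakrishnanMullerStein2015, Thm. 1.7] [cite: GreenbergLNM1716, Thm. 4.1 (p. 102)] -/
theorem padicValRat_bsd_rank_zero_of_mainConjecture_of_ram'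
    (hmod : nonempty_modularParametrizationData)
    (hSU : ∀ (W : WeierstrassCurve ℚ) [W.IsElliptic] [W.IsGloballyMinimal] (p : ℕ) [Fact p.Prime]
      (κ : ZpExtension ℚ p) (γ : Field.absoluteGaloisGroup ℚ) (N : ℕ) [NeZero N]
      (f : CuspForm (Gamma0 N) 2),
      skinner_urban_main_conjecture W p (κ := κ) (γ := γ) (f := f))
    (hS : Schneider1985_order_charGenerator) (hcan : exists_isCanonical)
    (hGr3 : ∀ (W : WeierstrassCurve ℚ) [W.IsElliptic] [W.IsGloballyMinimal] [Fact (3 : ℕ).Prime],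
      W.HasGoodReductionAtPrime 3 → ¬ ((3 : ℕ) : ℤ) ∣ W.frobeniusTrace 3 →
      ∀ (κ : ZpExtension ℚ 3) (γ : Field.absoluteGaloisGroup ℚ),
        κ.IsCyclotomic → κ.IsTopGenerator γ → IsCyclotomicVariable 3 γ →
      ∀ (D : W.SelmerDualData κ γ) [Module.Finite (IwasawaAlgebra 3) D.X], D.IsTorsion →
      ∀ (fE : IwasawaAlgebra 3), D.charIdeal = Ideal.span {fE} →
        Finite (W.selmerGroupPInfty 3) →
        ∃ u : ℤ_[3]ˣ,
          ((PowerSeries.constantCoeff fE : ℤ_[3]) : ℚ_[3]) *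
              (Nat.card (AddCommGroup.primaryComponent W.toAffine.Point 3) : ℚ_[3]) ^ 2 =
            ((u : ℤ_[3]) : ℚ_[3]) * ((3 : ℕ) : ℚ_[3]) ^ (padicValNat 3 W.tamagawaProduct) *
              (Nat.card (AddCommGroup.primaryComponent
                ((integralModelInt W).map (Int.castRingHom (ZMod 3))).toAffine.Point 3) : ℚ_[3]) ^ 2 *
              (Nat.card (W.selmerGroupPInfty 3) : ℚ_[3]))
    (hϖ : ∀ (W : WeierstrassCurve ℚ) [W.IsElliptic] [W.IsGloballyMinimal] (p : ℕ) [Fact p.Prime],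
      p ≠ 2 → W.HasGoodReductionAtPrime p → W.HasIrreducibleModPGaloisRep p →
      ∀ [NeZero (W.conductorNorm ℤ)] (f : CuspForm (Gamma0 (W.conductorNorm ℤ)) 2),
        IsNewformOf W f →
      ∀ ϖ : ℚ, (ϖ : ℝ) * W.realPeriodRat = plusPeriod f → padicValRat p ϖ = 0) :
    padicValRat_bsd_rank_zero := by
  refine padicValRat_bsd_rank_zero_of_mainConjecture_of_ram hmod hSU ?_ hϖ
  intro W _ _ p _ hp2 hgood hord κ γ hκ hγ hγ' D _ hX fE hfE hSel
  by_cases h3 : p = 3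
  · subst h3
    exact hGr3 W hgood hord κ γ hκ hγ hγ' D hX fE hfE hSel
  · exact greenberg_rankZero_of_Schneider1985 hS hcan W p
      ((Fact.out : p.Prime).five_le_of_ne_two_of_ne_three hp2 h3) hgood hord κ γ hκ hγ hγ' D hX fE
      hfE hSel

/-! ## §3. The integral main conjecture (bsd.S21 clause (3)) under mod-`p` surjectivity + (ram) -/

/-- **bsd.S21 with its `p`-adic premise discharged, for any `E/ℚ`**: at a prime `p ≥ 3` of good
ordinary reduction with `E[p]` irreducible, (ram) and `ρ̄_{E,p}` onto, `X(E/ℚ_∞)` is `Λ`-torsion and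
`char_Λ X(E/ℚ_∞) = (L_p(E,T))` INTEGRALLY in `Λ = ℤ_p⟦T⟧` — clauses (1) and (3) of
`skinner_urban_main_conjecture` (`hSU`), the premise "`ρ̄_{E,p^n}` onto for all `n`" of (3) coming
from surj + (ram) (`hasSurjectiveModNGaloisRep_pow_of_hasMultiplicativeReductionAtPrime`).  This is
the printed integral statement of Thm. 3.6.9 ("If the image of `ρ_{E,p}` is surjective, then this
equality holds in `Λ_ℚ`") read with `ρ̄_{E,p}` onto, which under (ram) is the same hypothesis.
[cite: SkinnerUrban2014, Thm. 3.6.9 (p. 45)] [cite: Serre1972, IV §3.4 Lemma 2] -/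
theorem mainConjecture_integral_of_surj_of_ram
    (hSU : ∀ (W : WeierstrassCurve ℚ) [W.IsElliptic] [W.IsGloballyMinimal] (p : ℕ) [Fact p.Prime]
      (κ : ZpExtension ℚ p) (γ : Field.absoluteGaloisGroup ℚ) (N : ℕ) [NeZero N]
      (f : CuspForm (Gamma0 N) 2),
      skinner_urban_main_conjecture W p (κ := κ) (γ := γ) (f := f))
    (W : WeierstrassCurve ℚ) [W.IsElliptic] [W.IsGloballyMinimal] (p : ℕ) [Fact p.Prime]
    (hp : 3 ≤ p) (hgood : W.HasGoodReductionAtPrime p) (hord : ¬ (p : ℤ) ∣ W.frobeniusTrace p)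
    (hirr : W.HasIrreducibleModPGaloisRep p)
    (haux : ∃ ℓ : ℕ, ∃ _ : Fact ℓ.Prime, ℓ ≠ p ∧ W.HasMultiplicativeReductionAtPrime ℓ ∧
      ¬ p ∣ padicValInt ℓ W.minimalDiscriminantInt)
    (hsurj : W.HasSurjectiveModNGaloisRep p)
    {κ : ZpExtension ℚ p} {γ : Field.absoluteGaloisGroup ℚ} (hκ : κ.IsCyclotomic)
    (hγ : κ.IsTopGenerator γ) (hγ' : IsCyclotomicVariable p γ) {N : ℕ} [NeZero N]
    {f : CuspForm (Gamma0 N) 2} (hf : IsNewformOf W f) (D : W.SelmerDualData κ γ) :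
    D.IsTorsion ∧
      ∃ g : IwasawaAlgebra p,
        iwasawaToPowerSeries p g = padicLFunction f (unitRoot W p : ℚ_[p]) ∧
          D.charIdeal = Ideal.span {g} := by
  obtain ⟨hX, -, hint⟩ := hSU W p κ γ N f hp hgood hord hirr haux hκ hγ hγ' hf D
  exact ⟨hX, hint (hasSurjectiveModNGaloisRep_pow_of_hasMultiplicativeReductionAtPrime W p hsurj haux)⟩

end Literature.NumberTheory.EllipticCurves.SkinnerUrban2014

end
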